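import Literature.NumberTheory.EllipticCurves.BinaryQuarticMinimisationThreeProofs
import HarnessLib

/-!
# Birch–Swinnerton-Dyer's minimisation lemma at `p = 2` (Bhargava–Shankar, Lemma 5.5), proved
# following Stoll–Cremona

`Proofs` companion of `Literature/NumberTheory/EllipticCurves/BinaryQuarticMinimisation.lean`,
discharging the named fact `Literature.NumberTheory.EllipticCurves.bsd_minimisation_two`
(Bhargava–Shankar, held arXiv text Lemma 5.5 = Birch–Swinnerton-Dyer, *Notes on elliptic
curves. I* (1963), Lemma 5): *an integral binary quartic form `f` with `2⁶ ∣ I(f)`, `2⁹ ∣ J(f)`,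
`2¹⁰ ∣ 8I(f) + J(f)` such that `z² = f(x, y)` is soluble over `ℚ₂` is equivalent to an integral
form with invariants `2⁻⁴ I(f)`, `2⁻⁶ J(f)`.* Third sequel of
`BinaryQuarticMinimisationPrimeProofs.lean` (`p ≥ 5`) and `…ThreeProofs.lean` (`p = 3`), whose
toolkit (the three moves of Stoll–Cremona's Lemma A.1, the divisibility bookkeeping, the
`ℚ_p`-insolubility step `not_isSoluble_of_valuations`, valid for every prime) is reused. With it,
all three minimisation lemmas quoted by Bhargava–Shankar from [BSD] are theorems of the tree.

## Source followed

M. Stoll, J. E. Cremona, *Minimal models for 2-coverings of elliptic curves*, LMS J. Comput.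
Math. 5 (2002) 220–243 (held), **Proposition A.5** (p. 240; = Prop. 4.5, p. 227: "In particular,
if `v(I) ≥ 6`, `v(J) ≥ 9` and `v(8I + J) ≥ 10`, then `Q` is nonminimal […] The last sentence is
essentially the statement of [BSD, Lemma 5]"), with **Lemma A.1** (the moves) and **Lemma A.2**
(p. 237: for residue characteristic `≠ 3` — so also for `p = 2` — a minimal quartic of positive
level has a quadruple root modulo `π`; its proof is the constructive treatment of the triple-root
case). The printed proof of Prop. A.5 treats the quadruple-root cases up to its last paragraph:
"The last statement can be proved along these lines by observing that the given conditions
ensure that there has to be a root modulo 16 if there is a quadruple root modulo 4. We do not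
give the details here". The details supplied below are elementary `2`-adic congruences on the
coefficients (no further idea is needed): in the normalised quadruple-root shape
`v(a,b,c,d,e) = (0, ≥1, ≥1, ≥1, ≥1)` the three hypotheses `2⁶ ∣ I`, `2⁹ ∣ J`, `2¹⁰ ∣ 8I + J` force
`v(c) ≥ 2`, `v(d) ≥ 3`, `v(e) ≥ 4` outright (the third hypothesis is the parity condition
`I/2⁶ ≡ J/2⁹ (mod 2)`, which is what excludes `v(e) = 2`), so that Lemma A.1(1) applies; each
congruence step is a finite check over `ℤ/2`, `ℤ/4` or `ℤ/8`, discharged by `decide`.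

## Proof architecture

* **The multiple root modulo `2`** (`f2_normalForm_table`, `exists_sl2_shape₂`): over `𝔽₂`,
  `I ≡ bd + c²`, `J ≡ bcd + ad² + eb²`; the nine nonzero forms over `𝔽₂` with `I = J = 0` are
  `x⁴, y⁴, (x+y)⁴` and the six forms `ℓ₁³ℓ₂`, and explicit elements of `SL₂(𝔽₂)` (lifted to
  `SL₂(ℤ)`) bring them to `a x⁴` or `b x³y` (a finite table, checked by `decide`).
* **Triple root** (proof of Lemma A.2, `v(2) = 1`: `v(12) = 2`, `v(72) = 3`): after the shear
  `x ↦ x + r y`, `r = −3bc` (so that `4 ∣ 3br + c`), `2⁴ ∣ I` and `2⁶ ∣ J` give `v(d) ≥ 4`,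
  `v(e) ≥ 6` (`chase_triple₂`); for `v(Q) = 0` this is Lemma A.1(2), for `v(Q) = 1` (applied to
  `Q/2`) Lemma A.1(1).
* **Quadruple root, `v(Q) = 1`** (`chase_quadruple₁₂` on `Q/2`): `v(a,b,c,d,e) ≥ (1,2,3,3,3)` with
  `v(a) = 1`; `v(e) = 3` contradicts `ℚ₂`-solubility (`v(Q(x,z))` odd), so `v(e) ≥ 4`: Lemma A.1(1).
* **Quadruple root, `v(Q) = 0`** (`chase_quadruple₀₂`, the paragraph "Therefore we suppose that
  `v(Q) = 0` …" of the printed proof plus the details of its last paragraph): Lemma A.1(1).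
* **Assembly** (`bsd_minimisation_two_holds`) by `v(Q) ≥ 2` / `= 1` / `= 0` and triple/quadruple,
  exactly as for `p = 3`; then the frontier corollaries of `…ThreeProofs.lean` lose the input
  `h55`.

## References

* [StollCremona2002] M. Stoll, J. E. Cremona, LMS J. Comput. Math. 5 (2002) 220–243,
  doi:10.1112/S1461157000000760: Prop. 4.5, Lemma 5.1, Lemma A.1, Lemma A.2, Prop. A.5 (p. 240).
* [BhargavaShankarAnnals2015] M. Bhargava, A. Shankar, Ann. of Math. (2) 181 (2015) 191–242 =
  arXiv:1006.1002, Lemma 5.5 (arXiv:1006.1002v2 numbering).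
* B. J. Birch, H. P. F. Swinnerton-Dyer, *Notes on elliptic curves. I*, J. reine angew. Math. 212
  (1963) 7–25, Lemma 5 (not held; quoted through the two sources above).
-/

noncomputable section

namespace Literature.NumberTheory.EllipticCurves

namespace BinaryQuartic

/-! ## Finite checks (by `decide`, before any classical instances are opened) -/

section Decide

set_option maxRecDepth 8000 in
set_option synthInstance.maxHeartbeats 400000 in
set_option synthInstance.maxSize 4096 in
/-- **Normal forms over `𝔽₂`** (the table behind `exists_sl2_shape₂`): a nonzero binary quartic
form over `𝔽₂` with `I = J = 0` is brought by `y ↦ y + t x`, `x ↦ x + r y` and possibly the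
rotation `(x, y) ↦ (−y, x)` to `a x⁴` (`a ≠ 0`) or `b x³ y` (`b ≠ 0`); all `32` forms are checked.
[cite: StollCremona2002, Lemma A.2 (proof: "the triple root is at zero (mod π), and the remaining root is at infinity")] -/
theorem f2_normalForm_table : ∀ a b c d e : ZMod 2, (a ≠ 0 ∨ b ≠ 0 ∨ c ≠ 0 ∨ d ≠ 0 ∨ e ≠ 0) →
    (⟨a, b, c, d, e⟩ : BinaryQuartic (ZMod 2)).I = 0 →
    (⟨a, b, c, d, e⟩ : BinaryQuartic (ZMod 2)).J = 0 →
    ∃ r t : ZMod 2, ∃ ε : Bool,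
      (((⟨a, b, c, d, e⟩ : BinaryQuartic (ZMod 2)).subst
            (!![1, t; 0, 1] * !![1, 0; r, 1] * !![0, 1; -1, 0] ^ (if ε then 1 else 0))).b = 0 ∧
        ((⟨a, b, c, d, e⟩ : BinaryQuartic (ZMod 2)).subst
            (!![1, t; 0, 1] * !![1, 0; r, 1] * !![0, 1; -1, 0] ^ (if ε then 1 else 0))).c = 0 ∧
        ((⟨a, b, c, d, e⟩ : BinaryQuartic (ZMod 2)).subst
            (!![1, t; 0, 1] * !![1, 0; r, 1] * !![0, 1; -1, 0] ^ (if ε then 1 else 0))).d = 0 ∧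
        ((⟨a, b, c, d, e⟩ : BinaryQuartic (ZMod 2)).subst
            (!![1, t; 0, 1] * !![1, 0; r, 1] * !![0, 1; -1, 0] ^ (if ε then 1 else 0))).e = 0 ∧
        ((⟨a, b, c, d, e⟩ : BinaryQuartic (ZMod 2)).subst
            (!![1, t; 0, 1] * !![1, 0; r, 1] * !![0, 1; -1, 0] ^ (if ε then 1 else 0))).a ≠ 0) ∨
      (((⟨a, b, c, d, e⟩ : BinaryQuartic (ZMod 2)).subst
            (!![1, t; 0, 1] * !![1, 0; r, 1] * !![0, 1; -1, 0] ^ (if ε then 1 else 0))).a = 0 ∧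
        ((⟨a, b, c, d, e⟩ : BinaryQuartic (ZMod 2)).subst
            (!![1, t; 0, 1] * !![1, 0; r, 1] * !![0, 1; -1, 0] ^ (if ε then 1 else 0))).c = 0 ∧
        ((⟨a, b, c, d, e⟩ : BinaryQuartic (ZMod 2)).subst
            (!![1, t; 0, 1] * !![1, 0; r, 1] * !![0, 1; -1, 0] ^ (if ε then 1 else 0))).d = 0 ∧
        ((⟨a, b, c, d, e⟩ : BinaryQuartic (ZMod 2)).subst
            (!![1, t; 0, 1] * !![1, 0; r, 1] * !![0, 1; -1, 0] ^ (if ε then 1 else 0))).e = 0 ∧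
        ((⟨a, b, c, d, e⟩ : BinaryQuartic (ZMod 2)).subst
            (!![1, t; 0, 1] * !![1, 0; r, 1] * !![0, 1; -1, 0] ^ (if ε then 1 else 0))).b ≠ 0) := by
  decide

/-! ### Parity and `2`-adic congruence facts for the quadruple-root chases

In the lemmas below the variables are the reduced coefficients: an odd coefficient is written
`2α + 1`, and `β, γ, δ, ε, …` are quotients of `b, c, d, e` by the powers of `2` already secured;
each hypothesis is (a multiple of) `I`, `J` or `8I + J` divided by the appropriate power of `2`
and read modulo `2`, `4`, `8` or `16`. [folklore] -/

/-- `J/4 (mod 2)` in the shape `(odd, 2β, 2γ, 2δ, 2ε)`: `δ` is even. [folklore] -/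
theorem q_step1 : ∀ α β γ δ ε : ZMod 2,
    72 * (2 * α + 1) * γ * ε + 18 * β * γ * δ - 27 * (2 * α + 1) * δ ^ 2 - 54 * ε * β ^ 2
      - 4 * γ ^ 3 = 0 → δ = 0 := by
  decide

/-- `I/4 (mod 2)` in the shape `(odd, 2β, 2γ, 4δ, 2ε)`: `γ` is even. [folklore] -/
theorem q_step2 : ∀ α β γ δ ε : ZMod 2,
    6 * (2 * α + 1) * ε - 6 * β * δ + γ ^ 2 = 0 → γ = 0 := by
  decide

/-- `J/8` and `I/8 (mod 2)` in the shape `(odd, 2β, 4γ, 4δ, 2ε)`: `ε` is even. [folklore] -/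
theorem q_step3 : ∀ α β γ δ ε : ZMod 2,
    72 * (2 * α + 1) * γ * ε + 36 * β * γ * δ - 54 * (2 * α + 1) * δ ^ 2 - 27 * ε * β ^ 2
      - 16 * γ ^ 3 = 0 →
    3 * (2 * α + 1) * ε - 3 * β * δ + 2 * γ ^ 2 = 0 → ε = 0 := by
  decide

/-- `I/8 (mod 2)` in the shape `(odd, 2(2β+1), 4γ, 4δ, 4ε)`: `δ` is even. [folklore] -/
theorem q02_s4a : ∀ α β γ δ ε : ZMod 2,
    6 * (2 * α + 1) * ε - 3 * (2 * β + 1) * δ + 2 * γ ^ 2 = 0 → δ = 0 := by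
  decide

/-- `J/16 (mod 2)` in the shape `(odd, 2(2β+1), 4γ, 8δ, 4ε)`: `ε` is even. [folklore] -/
theorem q02_s4b : ∀ α β γ δ ε : ZMod 2,
    72 * (2 * α + 1) * γ * ε + 18 * (2 * β + 1) * γ * (2 * δ) - 27 * (2 * α + 1) * (2 * δ) ^ 2
      - 27 * ε * (2 * β + 1) ^ 2 - 8 * γ ^ 3 = 0 → ε = 0 := by
  decide

/-- `J/32 (mod 2)` in the shape `(odd, 2(2β+1), 4γ, 8δ, 8ε)`: `ε` is even. [folklore] -/
theorem q02_s4c : ∀ α β γ δ ε : ZMod 2,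
    72 * (2 * α + 1) * γ * ε + 18 * (2 * β + 1) * γ * δ - 54 * (2 * α + 1) * δ ^ 2
      - 27 * ε * (2 * β + 1) ^ 2 - 4 * γ ^ 3 = 0 → ε = 0 := by
  decide

/-- `J/16 (mod 2)` in the shape `(odd, 4β, 4γ, 4δ, 4ε)`: `δ` is even. [folklore] -/
theorem q02_s5a : ∀ α β γ δ ε : ZMod 2,
    72 * (2 * α + 1) * γ * ε + 18 * (2 * β) * γ * δ - 27 * (2 * α + 1) * δ ^ 2
      - 27 * ε * (2 * β) ^ 2 - 8 * γ ^ 3 = 0 → δ = 0 := by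
  decide

/-- `I/16 (mod 2)` in the shape `(odd, 4β, 4γ, 8δ, 4(2ε+1))`: `γ` is odd. [folklore] -/
theorem q02_s5b : ∀ α β γ δ ε : ZMod 2,
    3 * (2 * α + 1) * (2 * ε + 1) - 6 * β * δ + γ ^ 2 = 0 → γ - 1 = 0 := by
  decide

/-- `I/16` and `J/64 (mod 4)` in the shape `(odd, 4β, 4(2γ+1), 8δ, 4(2ε+1))`: `β` and `δ` are
even and `ae/4 ≡ 1 (mod 4)`. [folklore] -/
theorem q02_alpha : ∀ α β γ δ ε : ZMod 4,
    3 * (2 * α + 1) * (2 * ε + 1) - 6 * β * δ + (2 * γ + 1) ^ 2 = 0 →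
    18 * (2 * α + 1) * (2 * γ + 1) * (2 * ε + 1) + 18 * β * (2 * γ + 1) * δ
      - 27 * (2 * α + 1) * δ ^ 2 - 27 * (2 * ε + 1) * β ^ 2 - 2 * (2 * γ + 1) ^ 3 = 0 →
    2 * β = 0 ∧ 2 * δ = 0 ∧ (2 * α + 1) * (2 * ε + 1) - 1 = 0 := by
  decide

/-- With `u = (2α+1)(2ε+1) ≡ 1 (mod 4)` and `c = 2γ + 1`: `8 ∣ 18uc − 2c³`. [folklore] -/
theorem q02_r1 : ∀ α γ ε : ZMod 8,
    2 * ((2 * α + 1) * (2 * ε + 1) - 1) = 0 →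
    18 * (2 * α + 1) * (2 * γ + 1) * (2 * ε + 1) - 2 * (2 * γ + 1) ^ 3 = 0 := by
  decide

/-- With `u ≡ 1 (mod 4)`: the part of `(2I + J)/64` involving `b` and `d` is `≡ 0 (mod 4)` once
it is even. [folklore] -/
theorem q02_r2 : ∀ α β γ δ ε : ZMod 4,
    (2 * α + 1) * (2 * ε + 1) - 1 = 0 →
    2 * (18 * β * (2 * γ + 1) * δ - 27 * (2 * α + 1) * δ ^ 2 - 27 * (2 * ε + 1) * β ^ 2
      - 12 * β * δ) = 0 →
    18 * β * (2 * γ + 1) * δ - 27 * (2 * α + 1) * δ ^ 2 - 27 * (2 * ε + 1) * β ^ 2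
      - 12 * β * δ = 0 := by
  decide

set_option maxRecDepth 8000 in
/-- With `u ≡ 1 (mod 4)`: the part of `(2I + J)/64 = I/2⁶ + J/2⁹ (times units)` not involving
`b, d` is `≡ 8 (mod 16)` — the parity obstruction behind Birch–Swinnerton-Dyer's hypothesis
`2¹⁰ ∣ 8I + J`. [folklore] -/
theorem q02_r3 : ∀ α γ ε : ZMod 16,
    4 * ((2 * α + 1) * (2 * ε + 1) - 1) = 0 →
    2 * (3 * (2 * α + 1) * (2 * ε + 1) + (2 * γ + 1) ^ 2)
      + (18 * (2 * α + 1) * (2 * γ + 1) * (2 * ε + 1) - 2 * (2 * γ + 1) ^ 3) - 8 = 0 := by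
  decide

/-- `I/16 (mod 2)` in the shape `(odd, 4β, 4γ, 8δ, 8ε)`: `γ` is even. [folklore] -/
theorem q02_s6a : ∀ α β γ δ ε : ZMod 2,
    3 * (2 * α + 1) * (2 * ε) - 6 * β * δ + γ ^ 2 = 0 → γ = 0 := by
  decide

/-- `J/64 (mod 2)` in the shape `(odd, 4β, 8γ, 8δ, 8ε)`: `δ` is even. [folklore] -/
theorem q02_s6b : ∀ α β γ δ ε : ZMod 2,
    18 * (2 * α + 1) * (2 * γ) * (2 * ε) + 18 * β * (2 * γ) * δ - 27 * (2 * α + 1) * δ ^ 2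
      - 27 * (2 * ε) * β ^ 2 - 2 * (2 * γ) ^ 3 = 0 → δ = 0 := by
  decide

/-- `I/32 (mod 2)` in the shape `(odd, 4β, 8γ, 16δ, 8ε)`: `ε` is even. [folklore] -/
theorem q02_s6c : ∀ α β γ δ ε : ZMod 2,
    3 * (2 * α + 1) * ε - 6 * β * δ + 2 * γ ^ 2 = 0 → ε = 0 := by
  decide

end Decide

open scoped Classical

/-! ## §C₂ The multiple root modulo `2`, integrally -/

section NormalFormTwo

/-- **The multiple root modulo `2`, integrally**: for an integral form `f`, nonzero modulo `2`,
with `2 ∣ I(f)` and `2 ∣ J(f)`, there is `M ∈ SL₂(ℤ)` with `f · M ≡ a x⁴` (`2 ∤ a`) or `≡ b x³ y`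
(`2 ∤ b`) modulo `2` (Stoll–Cremona, proof of Lemma A.2, here for `p = 2`).
[cite: StollCremona2002, Lemma A.2 (proof)] -/
theorem exists_sl2_shape₂ (f : BinaryQuartic ℤ)
    (hf : ¬ ((2 : ℤ) ∣ f.a ∧ (2 : ℤ) ∣ f.b ∧ (2 : ℤ) ∣ f.c ∧ (2 : ℤ) ∣ f.d ∧ (2 : ℤ) ∣ f.e))
    (hI : (2 : ℤ) ∣ f.I) (hJ : (2 : ℤ) ∣ f.J) :
    ∃ M : Matrix (Fin 2) (Fin 2) ℤ, M.det = 1 ∧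
      ((¬ (2 : ℤ) ∣ (f.subst M).a ∧ (2 : ℤ) ∣ (f.subst M).b ∧ (2 : ℤ) ∣ (f.subst M).c ∧
          (2 : ℤ) ∣ (f.subst M).d ∧ (2 : ℤ) ∣ (f.subst M).e) ∨
        ((2 : ℤ) ∣ (f.subst M).a ∧ ¬ (2 : ℤ) ∣ (f.subst M).b ∧ (2 : ℤ) ∣ (f.subst M).c ∧
          (2 : ℤ) ∣ (f.subst M).d ∧ (2 : ℤ) ∣ (f.subst M).e)) := by
  set φ := Int.castRingHom (ZMod 2) with hφ
  have hdvd : ∀ z : ℤ, φ z = 0 ↔ (2 : ℤ) ∣ z := fun z ↦ by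
    rw [hφ, eq_intCast, ZMod.intCast_zmod_eq_zero_iff_dvd]; norm_num
  set g := f.map φ with hg
  have hg0 : g.a ≠ 0 ∨ g.b ≠ 0 ∨ g.c ≠ 0 ∨ g.d ≠ 0 ∨ g.e ≠ 0 := by
    simp only [hg, map_a, map_b, map_c, map_d, map_e, ne_eq, hdvd]
    tauto
  have hgI : g.I = 0 := by rw [hg, I_map, hdvd]; exact hI
  have hgJ : g.J = 0 := by rw [hg, J_map, hdvd]; exact hJ
  obtain ⟨r, t, ε, hshape⟩ := f2_normalForm_table g.a g.b g.c g.d g.e hg0 hgI hgJ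
  set n : ℕ := if ε then 1 else 0 with hn
  set M : Matrix (Fin 2) (Fin 2) ℤ :=
    !![1, (t.val : ℤ); 0, 1] * !![1, 0; (r.val : ℤ), 1] * !![0, 1; -1, 0] ^ n with hM
  have hMdet : M.det = 1 := by
    rw [hM, Matrix.det_mul, Matrix.det_mul, Matrix.det_pow, det_upperShear, det_lowerShear,
      det_swap]
    simp
  have hMmap : M.map φ = !![1, t; 0, 1] * !![1, 0; r, 1] * !![0, 1; -1, 0] ^ n := by
    rw [← RingHom.mapMatrix_apply, hM, map_mul, map_mul, map_pow]
    simp only [RingHom.mapMatrix_apply, map_fin_two]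
    simp [hφ]
  have hsub : (f.subst M).map φ = g.subst (!![1, t; 0, 1] * !![1, 0; r, 1] * !![0, 1; -1, 0] ^ n) := by
    rw [map_subst, hMmap]
  have ca : (2 : ℤ) ∣ (f.subst M).a ↔
      (g.subst (!![1, t; 0, 1] * !![1, 0; r, 1] * !![0, 1; -1, 0] ^ n)).a = 0 := by
    rw [← hdvd, ← map_a φ (f.subst M), hsub]
  have cb : (2 : ℤ) ∣ (f.subst M).b ↔
      (g.subst (!![1, t; 0, 1] * !![1, 0; r, 1] * !![0, 1; -1, 0] ^ n)).b = 0 := by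
    rw [← hdvd, ← map_b φ (f.subst M), hsub]
  have cc : (2 : ℤ) ∣ (f.subst M).c ↔
      (g.subst (!![1, t; 0, 1] * !![1, 0; r, 1] * !![0, 1; -1, 0] ^ n)).c = 0 := by
    rw [← hdvd, ← map_c φ (f.subst M), hsub]
  have cd : (2 : ℤ) ∣ (f.subst M).d ↔
      (g.subst (!![1, t; 0, 1] * !![1, 0; r, 1] * !![0, 1; -1, 0] ^ n)).d = 0 := by
    rw [← hdvd, ← map_d φ (f.subst M), hsub]
  have ce : (2 : ℤ) ∣ (f.subst M).e ↔
      (g.subst (!![1, t; 0, 1] * !![1, 0; r, 1] * !![0, 1; -1, 0] ^ n)).e = 0 := by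
    rw [← hdvd, ← map_e φ (f.subst M), hsub]
  refine ⟨M, hMdet, ?_⟩
  rw [ca, cb, cc, cd, ce]
  rcases hshape with ⟨hb, hc, hd, he, ha⟩ | ⟨ha, hc, hd, he, hb⟩
  · exact Or.inl ⟨ha, hb, hc, hd, he⟩
  · exact Or.inr ⟨ha, hb, hc, hd, he⟩

end NormalFormTwo

/-! ## §D₂ Divisibility bookkeeping at `2` and the chases -/

section Two

/-- Small facts about `2`. [folklore] -/
theorem two_prime_facts : Prime (2 : ℤ) ∧ ¬ (2 : ℤ) ∣ 3 ∧ ¬ (2 : ℤ) ∣ 9 ∧ ¬ (2 : ℤ) ∣ 27 ∧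
    (2 : ℤ) ^ 1 ∣ 2 ∧ (2 : ℤ) ^ 2 ∣ 12 ∧ (2 : ℤ) ^ 3 ∣ 72 ∧ (2 : ℤ) ^ 3 ∣ 8 := by
  refine ⟨Int.prime_two, by decide, by decide, by decide, by norm_num, by norm_num, by norm_num,
    by norm_num⟩

/-- An odd integer is `2t + 1`. [folklore] -/
theorem exists_eq_two_mul_add_one {a : ℤ} (ha : ¬ (2 : ℤ) ∣ a) : ∃ t : ℤ, a = 2 * t + 1 :=
  Int.not_even_iff_odd.mp fun h ↦ ha (even_iff_two_dvd.mp h)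

/-- Peeling a power: `P ^ m ∣ x`, `x = P ^ k y`, `m = k + n` give `P ^ n ∣ y`. [folklore] -/
theorem dvd_of_dvd_of_eq_mul {P x y : ℤ} {m n : ℕ} (k : ℕ) (h : P ^ m ∣ x) (he : x = P ^ k * y)
    (hm : m = k + n) (hP : P ≠ 0) : P ^ n ∣ y := by
  subst hm
  rw [he, pow_add] at h
  exact (mul_dvd_mul_iff_left (pow_ne_zero k hP)).mp h

/-- From `m ∣ x` with `m = n` to `x = 0` in `ℤ/n`. [folklore] -/
theorem cast_zmod_eq_zero_of_dvd {n : ℕ} {m x : ℤ} (h : m ∣ x) (hm : m = n) : (x : ZMod n) = 0 := by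
  subst hm
  exact (ZMod.intCast_zmod_eq_zero_iff_dvd x n).mpr h

/-- From `x = 0` in `ℤ/n` to `(n : ℤ) ∣ x`. [folklore] -/
theorem dvd_of_cast_zmod_eq_zero {n : ℕ} {x : ℤ} (h : (x : ZMod n) = 0) : (n : ℤ) ∣ x :=
  (ZMod.intCast_zmod_eq_zero_iff_dvd x n).mp h

/-- Shear parameter for the triple-root cases at `2`: for `b` odd and `c` even, `r = −3bc` is even
and `4 ∣ 3br + c` (as `9b² ≡ 1 (mod 8)`; Stoll–Cremona, proof of Lemma A.2: "`3b₁α ≡ −c mod π²`").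
[cite: StollCremona2002, Lemma A.2 (proof)] -/
theorem exists_shear₂ {b c : ℤ} (hb : ¬ (2 : ℤ) ∣ b) (hc : (2 : ℤ) ∣ c) :
    ∃ r : ℤ, (2 : ℤ) ∣ r ∧ (2 : ℤ) ^ 2 ∣ 3 * b * r + c := by
  obtain ⟨k, rfl⟩ := exists_eq_two_mul_add_one hb
  obtain ⟨c', rfl⟩ := hc
  exact ⟨-(3 * (2 * k + 1) * (2 * c')), ⟨-(3 * (2 * k + 1) * c'), by ring⟩,
    ⟨-(2 * c' * (9 * k ^ 2 + 9 * k + 2)), by ring⟩⟩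

/-- **Chase, triple root** (Stoll–Cremona, proof of Lemma A.2 with `v(2) = 1`, after the shear):
from `v(a,b,c,d,e) ≥ (1,0,2,1,1)`, `2 ∤ b`, `2⁴ ∣ I`, `2⁶ ∣ J`: "we deduce from `v(I₁) ≥ …` that
`v(d₁) ≥ …`, and then from `v(J₁) ≥ …` that `v(e₁) ≥ …`": here `v(d) ≥ 4` (the term `3bd` of `I`)
and `v(e) ≥ 6` (the term `27eb²` of `J`). [cite: StollCremona2002, Lemma A.2 (proof)] -/
theorem chase_triple₂ {a b c d e : ℤ} (ha : (2 : ℤ) ∣ a) (hb : ¬ (2 : ℤ) ∣ b)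
    (hc : (2 : ℤ) ^ 2 ∣ c) (he : (2 : ℤ) ∣ e)
    (hI : (2 : ℤ) ^ 4 ∣ 12 * a * e - 3 * b * d + c ^ 2)
    (hJ : (2 : ℤ) ^ 6 ∣ 72 * a * c * e + 9 * b * c * d - 27 * a * d ^ 2 - 27 * e * b ^ 2 - 2 * c ^ 3) :
    (2 : ℤ) ^ 4 ∣ d ∧ (2 : ℤ) ^ 6 ∣ e := by
  obtain ⟨hP, h3, -, h27, h2, h12, -, h8⟩ := two_prime_facts
  have h3b : ¬ (2 : ℤ) ∣ 3 * b := fun h ↦ (hP.dvd_mul.mp h).elim h3 hb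
  have hb2 : ¬ (2 : ℤ) ∣ b ^ 2 := fun h ↦ hb (hP.dvd_of_dvd_pow h)
  have ha1 : (2 : ℤ) ^ 1 ∣ a := by rwa [pow_one]
  have he1 : (2 : ℤ) ^ 1 ∣ e := by rwa [pow_one]
  set Iₑ := 12 * a * e - 3 * b * d + c ^ 2 with hIₑ
  set Jₑ := 72 * a * c * e + 9 * b * c * d - 27 * a * d ^ 2 - 27 * e * b ^ 2 - 2 * c ^ 3 with hJₑ
  -- `v(d) ≥ 4`
  have hd4 : (2 : ℤ) ^ 4 ∣ d := by
    refine hP.pow_dvd_of_dvd_mul_left 4 h3b ?_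
    have e1 : 3 * b * d = 1 * 12 * a * e + c ^ 2 + (-1) * Iₑ := by rw [hIₑ]; ring
    rw [e1]
    refine dvd_add (dvd_add ?_ ?_) (hI.mul_left _)
    · exact pow_dvd_of_le (pow_dvd_mul₃ h12 ha1 he1 1) (by norm_num)
    · exact pow_dvd_of_le (pow_dvd_sq_of_dvd hc) (by norm_num)
  -- `v(e) ≥ 6`
  have he6 : (2 : ℤ) ^ 6 ∣ e := by
    refine hP.pow_dvd_of_dvd_mul_left 6 h27 (hP.pow_dvd_of_dvd_mul_right 6 hb2 ?_)
    have e2 : 27 * e * b ^ 2 = 9 * 8 * a * c * e + 9 * b * c * d + (-27) * a * d ^ 2 +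
        (-1) * 2 * c ^ 3 + (-1) * Jₑ := by rw [hJₑ]; ring
    rw [e2]
    refine dvd_add (dvd_add (dvd_add (dvd_add ?_ ?_) ?_) ?_) (hJ.mul_left _)
    · exact pow_dvd_of_le (pow_dvd_mul₄ h8 ha1 hc he1 9) (by norm_num)
    · exact pow_dvd_of_le (pow_dvd_mul₂ hc hd4 (9 * b)) (by norm_num)
    · exact pow_dvd_of_le (pow_dvd_mul₂ ha1 (pow_dvd_sq_of_dvd hd4) (-27)) (by norm_num)
    · exact pow_dvd_of_le (pow_dvd_mul₂ h2 (pow_dvd_cube_of_dvd hc) (-1)) (by norm_num)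
  exact ⟨hd4, he6⟩

/-- **Chase, quadruple root, first three steps** (Stoll–Cremona, proof of Prop. A.5: "The
valuations of `J` and `I` imply that `v(d) ≥ 2` and `v(c) ≥ 2`, respectively. The assumption that
`v(e) = 1` leads (by `J`) to `v(b) ≥ 2` and then to the contradiction `v(I) = 3`, so `v(e) ≥ 2`
also"): from `2 ∤ a`, `2 ∣ b, c, d, e`, `2⁴ ∣ I`, `2⁴ ∣ J` one gets `4 ∣ c`, `4 ∣ d`, `4 ∣ e`. Used
for `Q/2` when `v(Q) = 1` and as the start of `chase_quadruple₀₂` when `v(Q) = 0`.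
[cite: StollCremona2002, Prop. A.5 (proof)] -/
theorem chase_quadruple₁₂ {a b c d e : ℤ} (ha : ¬ (2 : ℤ) ∣ a) (hb : (2 : ℤ) ∣ b)
    (hc : (2 : ℤ) ∣ c) (hd : (2 : ℤ) ∣ d) (he : (2 : ℤ) ∣ e)
    (hI : (2 : ℤ) ^ 4 ∣ 12 * a * e - 3 * b * d + c ^ 2)
    (hJ : (2 : ℤ) ^ 4 ∣ 72 * a * c * e + 9 * b * c * d - 27 * a * d ^ 2 - 27 * e * b ^ 2 - 2 * c ^ 3) :
    (2 : ℤ) ^ 2 ∣ c ∧ (2 : ℤ) ^ 2 ∣ d ∧ (2 : ℤ) ^ 2 ∣ e := by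
  obtain ⟨α, rfl⟩ := exists_eq_two_mul_add_one ha
  obtain ⟨β, rfl⟩ := hb
  obtain ⟨γ, rfl⟩ := hc
  obtain ⟨δ, rfl⟩ := hd
  obtain ⟨ε, rfl⟩ := he
  -- `δ` even, from `J/4 (mod 2)`
  have hJ₁ : (2 : ℤ) ^ 1 ∣ 72 * (2 * α + 1) * γ * ε + 18 * β * γ * δ - 27 * (2 * α + 1) * δ ^ 2
      - 54 * ε * β ^ 2 - 4 * γ ^ 3 :=
    pow_dvd_of_le (dvd_of_dvd_of_eq_mul (n := 2) 2 hJ (by ring) rfl two_ne_zero) (by norm_num)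
  have hδ : (2 : ℤ) ∣ δ := by
    have hz := cast_zmod_eq_zero_of_dvd (n := 2) hJ₁ (by norm_num)
    push_cast at hz
    exact_mod_cast dvd_of_cast_zmod_eq_zero (q_step1 _ _ _ _ _ hz)
  obtain ⟨δ, rfl⟩ := hδ
  -- `γ` even, from `I/4 (mod 2)`
  have hI₁ : (2 : ℤ) ^ 1 ∣ 6 * (2 * α + 1) * ε - 6 * β * δ + γ ^ 2 :=
    pow_dvd_of_le (dvd_of_dvd_of_eq_mul (n := 2) 2 hI (by ring) rfl two_ne_zero) (by norm_num)
  have hγ : (2 : ℤ) ∣ γ := by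
    have hz := cast_zmod_eq_zero_of_dvd (n := 2) hI₁ (by norm_num)
    push_cast at hz
    exact_mod_cast dvd_of_cast_zmod_eq_zero (q_step2 _ _ _ _ _ hz)
  obtain ⟨γ, rfl⟩ := hγ
  -- `ε` even, from `J/8` and `I/8 (mod 2)`
  have hJ₂ : (2 : ℤ) ^ 1 ∣ 72 * (2 * α + 1) * γ * ε + 36 * β * γ * δ - 54 * (2 * α + 1) * δ ^ 2
      - 27 * ε * β ^ 2 - 16 * γ ^ 3 :=
    dvd_of_dvd_of_eq_mul 3 hJ (by ring) rfl two_ne_zero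
  have hI₂ : (2 : ℤ) ^ 1 ∣ 3 * (2 * α + 1) * ε - 3 * β * δ + 2 * γ ^ 2 :=
    dvd_of_dvd_of_eq_mul 3 hI (by ring) rfl two_ne_zero
  have hε : (2 : ℤ) ∣ ε := by
    have hz := cast_zmod_eq_zero_of_dvd (n := 2) hJ₂ (by norm_num)
    have hz' := cast_zmod_eq_zero_of_dvd (n := 2) hI₂ (by norm_num)
    push_cast at hz hz'
    exact_mod_cast dvd_of_cast_zmod_eq_zero (q_step3 _ _ _ _ _ hz hz')
  obtain ⟨ε, rfl⟩ := hε
  exact ⟨⟨γ, by ring⟩, ⟨δ, by ring⟩, ⟨ε, by ring⟩⟩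

/-- **Chase, quadruple root, `v(Q) = 0`** (Stoll–Cremona, proof of Prop. A.5, paragraph
"Therefore we suppose that `v(Q) = 0` …" together with the details of its last paragraph, "the
given conditions ensure that there has to be a root modulo `16` if there is a quadruple root
modulo `4`"): from `2 ∤ a`, `2 ∣ b, c, d, e`, `2⁶ ∣ I`, `2⁹ ∣ J`, `2¹⁰ ∣ 8I + J` one gets `4 ∣ c`,
`8 ∣ d`, `16 ∣ e`, i.e. the hypotheses of Lemma A.1(1). After `chase_quadruple₁₂`: if `v(b) = 1`
then `v(d) ≥ 3`, `v(e) ≥ 4` from `I`, `J` ("then `v(b) = 1`, from which we deduce that `v(d) ≥ 3`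
and `v(e) ≥ 4`"); if `v(b) ≥ 2` (a quadruple root modulo `4`) then `v(d) ≥ 3` from `J`, `v(e) = 2`
is excluded by the parity condition `2¹⁰ ∣ 8I + J` together with `I (mod 2⁷)`, `J (mod 2⁹)`
(`q02_alpha`, `q02_r1`–`q02_r3`), `v(e) = 3` by `I`, `J` again.
[cite: StollCremona2002, Prop. A.5 (proof)] -/
theorem chase_quadruple₀₂ {a b c d e : ℤ} (ha : ¬ (2 : ℤ) ∣ a) (hb : (2 : ℤ) ∣ b)
    (hc : (2 : ℤ) ∣ c) (hd : (2 : ℤ) ∣ d) (he : (2 : ℤ) ∣ e)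
    (hI : (2 : ℤ) ^ 6 ∣ 12 * a * e - 3 * b * d + c ^ 2)
    (hJ : (2 : ℤ) ^ 9 ∣ 72 * a * c * e + 9 * b * c * d - 27 * a * d ^ 2 - 27 * e * b ^ 2 - 2 * c ^ 3)
    (hK : (2 : ℤ) ^ 10 ∣ 8 * (12 * a * e - 3 * b * d + c ^ 2) +
      (72 * a * c * e + 9 * b * c * d - 27 * a * d ^ 2 - 27 * e * b ^ 2 - 2 * c ^ 3)) :
    (2 : ℤ) ^ 2 ∣ c ∧ (2 : ℤ) ^ 3 ∣ d ∧ (2 : ℤ) ^ 4 ∣ e := by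
  obtain ⟨hc4, hd4, he4⟩ := chase_quadruple₁₂ ha hb hc hd he (pow_dvd_of_le hI (by norm_num))
    (pow_dvd_of_le hJ (by norm_num))
  obtain ⟨α, rfl⟩ := exists_eq_two_mul_add_one ha
  obtain ⟨b₁, rfl⟩ := hb
  obtain ⟨c₂, rfl⟩ := hc4
  obtain ⟨d₂, rfl⟩ := hd4
  obtain ⟨e₂, rfl⟩ := he4
  refine ⟨⟨c₂, by ring⟩, ?_⟩
  -- the reduced invariants: `I = 8 I₃`, `J = 16 J₃`, `8I + J = 16 (4 I₃ + J₃)`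
  have hI₃ : (2 : ℤ) ^ 3 ∣ 6 * (2 * α + 1) * e₂ - 3 * b₁ * d₂ + 2 * c₂ ^ 2 :=
    dvd_of_dvd_of_eq_mul 3 hI (by ring) rfl two_ne_zero
  have hJ₃ : (2 : ℤ) ^ 5 ∣ 72 * (2 * α + 1) * c₂ * e₂ + 18 * b₁ * c₂ * d₂ - 27 * (2 * α + 1) * d₂ ^ 2
      - 27 * e₂ * b₁ ^ 2 - 8 * c₂ ^ 3 :=
    dvd_of_dvd_of_eq_mul 4 hJ (by ring) rfl two_ne_zero
  have hK₃ : (2 : ℤ) ^ 6 ∣ 4 * (6 * (2 * α + 1) * e₂ - 3 * b₁ * d₂ + 2 * c₂ ^ 2) +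
      (72 * (2 * α + 1) * c₂ * e₂ + 18 * b₁ * c₂ * d₂ - 27 * (2 * α + 1) * d₂ ^ 2
        - 27 * e₂ * b₁ ^ 2 - 8 * c₂ ^ 3) :=
    dvd_of_dvd_of_eq_mul 4 hK (by ring) rfl two_ne_zero
  clear hI hJ hK
  rcases Int.even_or_odd' b₁ with ⟨b₂, rfl | rfl⟩
  · -- `v(b) ≥ 2`: a quadruple root modulo `4`
    -- `d₂` even, from `J/16 (mod 2)`
    have hd₂ : (2 : ℤ) ∣ d₂ := by
      have hz := cast_zmod_eq_zero_of_dvd (n := 2) (pow_dvd_of_le (i := 1) hJ₃ (by norm_num)) (by norm_num)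
      push_cast at hz
      exact_mod_cast dvd_of_cast_zmod_eq_zero (q02_s5a _ _ _ _ _ hz)
    obtain ⟨d₃, rfl⟩ := hd₂
    refine ⟨⟨d₃, by ring⟩, ?_⟩
    have hI₄ : (2 : ℤ) ^ 2 ∣ 3 * (2 * α + 1) * e₂ - 6 * b₂ * d₃ + c₂ ^ 2 :=
      dvd_of_dvd_of_eq_mul 1 hI₃ (by ring) rfl two_ne_zero
    have hJ₄ : (2 : ℤ) ^ 3 ∣ 18 * (2 * α + 1) * c₂ * e₂ + 18 * b₂ * c₂ * d₃
        - 27 * (2 * α + 1) * d₃ ^ 2 - 27 * e₂ * b₂ ^ 2 - 2 * c₂ ^ 3 :=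
      dvd_of_dvd_of_eq_mul 2 hJ₃ (by ring) rfl two_ne_zero
    have hK₄ : (2 : ℤ) ^ 4 ∣ 2 * (3 * (2 * α + 1) * e₂ - 6 * b₂ * d₃ + c₂ ^ 2) +
        (18 * (2 * α + 1) * c₂ * e₂ + 18 * b₂ * c₂ * d₃
          - 27 * (2 * α + 1) * d₃ ^ 2 - 27 * e₂ * b₂ ^ 2 - 2 * c₂ ^ 3) :=
      dvd_of_dvd_of_eq_mul 2 hK₃ (by ring) rfl two_ne_zero
    clear hI₃ hJ₃ hK₃
    rcases Int.even_or_odd' e₂ with ⟨e₃, rfl | rfl⟩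
    · -- `v(e) ≥ 3`: then `v(c) ≥ 3`, `v(d) ≥ 4`, `v(e) ≥ 4` from `I`, `J`, `I`
      have hc₂ : (2 : ℤ) ∣ c₂ := by
        have hz := cast_zmod_eq_zero_of_dvd (n := 2) (pow_dvd_of_le (i := 1) hI₄ (by norm_num)) (by norm_num)
        push_cast at hz
        exact_mod_cast dvd_of_cast_zmod_eq_zero (q02_s6a _ _ _ _ _ hz)
      obtain ⟨c₃, rfl⟩ := hc₂
      have hd₃ : (2 : ℤ) ∣ d₃ := by
        have hz := cast_zmod_eq_zero_of_dvd (n := 2) (pow_dvd_of_le (i := 1) hJ₄ (by norm_num)) (by norm_num)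
        push_cast at hz
        exact_mod_cast dvd_of_cast_zmod_eq_zero (q02_s6b _ _ _ _ _ hz)
      obtain ⟨d₄, rfl⟩ := hd₃
      have hI₅ : (2 : ℤ) ^ 1 ∣ 3 * (2 * α + 1) * e₃ - 6 * b₂ * d₄ + 2 * c₃ ^ 2 :=
        dvd_of_dvd_of_eq_mul 1 hI₄ (by ring) rfl two_ne_zero
      have he₃ : (2 : ℤ) ∣ e₃ := by
        have hz := cast_zmod_eq_zero_of_dvd (n := 2) hI₅ (by norm_num)
        push_cast at hz
        exact_mod_cast dvd_of_cast_zmod_eq_zero (q02_s6c _ _ _ _ _ hz)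
      obtain ⟨e₄, rfl⟩ := he₃
      exact ⟨e₄, by ring⟩
    · -- `v(e) = 2` is impossible: the parity obstruction
      exfalso
      -- `c₂` odd, from `I/16 (mod 2)`
      have hc₂ : (2 : ℤ) ∣ c₂ - 1 := by
        have hz := cast_zmod_eq_zero_of_dvd (n := 2) (pow_dvd_of_le (i := 1) hI₄ (by norm_num)) (by norm_num)
        push_cast at hz
        exact_mod_cast dvd_of_cast_zmod_eq_zero (by push_cast; exact q02_s5b _ _ _ _ _ hz)
      obtain ⟨c₃, hc₃⟩ := hc₂
      obtain rfl : c₂ = 2 * c₃ + 1 := by omega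
      -- `b₂`, `d₃` even and `u := (2α+1)(2e₃+1) ≡ 1 (mod 4)`, from `I/16`, `J/64 (mod 4)`
      have hzI := cast_zmod_eq_zero_of_dvd (n := 4) hI₄ (by norm_num)
      have hzJ := cast_zmod_eq_zero_of_dvd (n := 4) (pow_dvd_of_le (i := 2) hJ₄ (by norm_num)) (by norm_num)
      push_cast at hzI hzJ
      obtain ⟨kb, kd, ku⟩ := q02_alpha _ _ _ _ _ hzI hzJ
      have hb₂ : (4 : ℤ) ∣ 2 * b₂ := by exact_mod_cast dvd_of_cast_zmod_eq_zero (by push_cast; exact kb)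
      have hd₃ : (4 : ℤ) ∣ 2 * d₃ := by exact_mod_cast dvd_of_cast_zmod_eq_zero (by push_cast; exact kd)
      have hu : (4 : ℤ) ∣ (2 * α + 1) * (2 * e₃ + 1) - 1 := by
        exact_mod_cast dvd_of_cast_zmod_eq_zero (by push_cast; exact ku)
      obtain ⟨b₃, hb₃⟩ := hb₂
      obtain rfl : b₂ = 2 * b₃ := by omega
      obtain ⟨d₄, hd₄⟩ := hd₃
      obtain rfl : d₃ = 2 * d₄ := by omega
      clear hb₃ hd₄ hc₃ kb kd ku hzI hzJ
      -- `8 ∣ B := 18uc − 2c³`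
      have hB : (8 : ℤ) ∣ 18 * (2 * α + 1) * (2 * c₃ + 1) * (2 * e₃ + 1) - 2 * (2 * c₃ + 1) ^ 3 := by
        have hz := cast_zmod_eq_zero_of_dvd (n := 8) (mul_dvd_mul_left (2 : ℤ) hu) (by norm_num)
        push_cast at hz
        exact_mod_cast dvd_of_cast_zmod_eq_zero (by push_cast; exact q02_r1 _ _ _ hz)
      -- `4 ∣ R'`, the `b, d`-part
      have hR2 : (2 : ℤ) ∣ 18 * b₃ * (2 * c₃ + 1) * d₄ - 27 * (2 * α + 1) * d₄ ^ 2
          - 27 * (2 * e₃ + 1) * b₃ ^ 2 - 12 * b₃ * d₄ := by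
        have h8 : (8 : ℤ) ∣ 18 * (2 * α + 1) * (2 * c₃ + 1) * (2 * e₃ + 1) + 18 * (2 * b₃) * (2 * c₃ + 1) * (2 * d₄)
            - 27 * (2 * α + 1) * (2 * d₄) ^ 2 - 27 * (2 * e₃ + 1) * (2 * b₃) ^ 2 - 2 * (2 * c₃ + 1) ^ 3 := by
          simpa using hJ₄
        have e1 : 18 * (2 * α + 1) * (2 * c₃ + 1) * (2 * e₃ + 1) + 18 * (2 * b₃) * (2 * c₃ + 1) * (2 * d₄)
            - 27 * (2 * α + 1) * (2 * d₄) ^ 2 - 27 * (2 * e₃ + 1) * (2 * b₃) ^ 2 - 2 * (2 * c₃ + 1) ^ 3 =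
            (18 * (2 * α + 1) * (2 * c₃ + 1) * (2 * e₃ + 1) - 2 * (2 * c₃ + 1) ^ 3) +
            4 * (18 * b₃ * (2 * c₃ + 1) * d₄ - 27 * (2 * α + 1) * d₄ ^ 2
              - 27 * (2 * e₃ + 1) * b₃ ^ 2 - 12 * b₃ * d₄) + 48 * (b₃ * d₄) := by ring
        rw [e1] at h8
        omega
      have hR4 : (4 : ℤ) ∣ 18 * b₃ * (2 * c₃ + 1) * d₄ - 27 * (2 * α + 1) * d₄ ^ 2
          - 27 * (2 * e₃ + 1) * b₃ ^ 2 - 12 * b₃ * d₄ := by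
        have hz := cast_zmod_eq_zero_of_dvd (n := 4) hu (by norm_num)
        have hz' := cast_zmod_eq_zero_of_dvd (n := 4) (mul_dvd_mul_left (2 : ℤ) hR2) (by norm_num)
        push_cast at hz hz'
        exact_mod_cast dvd_of_cast_zmod_eq_zero (by push_cast; exact q02_r2 _ _ _ _ _ hz hz')
      -- `2A + B ≡ 8 (mod 16)`, the `a, c, e`-part
      have hS : (16 : ℤ) ∣ 2 * (3 * (2 * α + 1) * (2 * e₃ + 1) + (2 * c₃ + 1) ^ 2) +
          (18 * (2 * α + 1) * (2 * c₃ + 1) * (2 * e₃ + 1) - 2 * (2 * c₃ + 1) ^ 3) - 8 := by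
        have hz := cast_zmod_eq_zero_of_dvd (n := 16) (mul_dvd_mul_left (4 : ℤ) hu) (by norm_num)
        push_cast at hz
        exact_mod_cast dvd_of_cast_zmod_eq_zero (by push_cast; exact q02_r3 _ _ _ hz)
      -- but `16 ∣ 2 I₄ + J₄ = (2A + B) + 4 R'`
      have h16 : (16 : ℤ) ∣ 2 * (3 * (2 * α + 1) * (2 * e₃ + 1) - 6 * (2 * b₃) * (2 * d₄) + (2 * c₃ + 1) ^ 2) +
          (18 * (2 * α + 1) * (2 * c₃ + 1) * (2 * e₃ + 1) + 18 * (2 * b₃) * (2 * c₃ + 1) * (2 * d₄)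
            - 27 * (2 * α + 1) * (2 * d₄) ^ 2 - 27 * (2 * e₃ + 1) * (2 * b₃) ^ 2 - 2 * (2 * c₃ + 1) ^ 3) := by
        simpa using hK₄
      have e2 : 2 * (3 * (2 * α + 1) * (2 * e₃ + 1) - 6 * (2 * b₃) * (2 * d₄) + (2 * c₃ + 1) ^ 2) +
          (18 * (2 * α + 1) * (2 * c₃ + 1) * (2 * e₃ + 1) + 18 * (2 * b₃) * (2 * c₃ + 1) * (2 * d₄)
            - 27 * (2 * α + 1) * (2 * d₄) ^ 2 - 27 * (2 * e₃ + 1) * (2 * b₃) ^ 2 - 2 * (2 * c₃ + 1) ^ 3) =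
          (2 * (3 * (2 * α + 1) * (2 * e₃ + 1) + (2 * c₃ + 1) ^ 2) +
            (18 * (2 * α + 1) * (2 * c₃ + 1) * (2 * e₃ + 1) - 2 * (2 * c₃ + 1) ^ 3)) +
          4 * (18 * b₃ * (2 * c₃ + 1) * d₄ - 27 * (2 * α + 1) * d₄ ^ 2
            - 27 * (2 * e₃ + 1) * b₃ ^ 2 - 12 * b₃ * d₄) := by ring
      rw [e2] at h16
      omega
  · -- `v(b) = 1`: then `v(d) ≥ 3` from `I`, and `v(e) ≥ 3`, `v(e) ≥ 4` from `J`
    have hd₂ : (2 : ℤ) ∣ d₂ := by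
      have hz := cast_zmod_eq_zero_of_dvd (n := 2) (pow_dvd_of_le (i := 1) hI₃ (by norm_num)) (by norm_num)
      push_cast at hz
      exact_mod_cast dvd_of_cast_zmod_eq_zero (q02_s4a _ _ _ _ _ hz)
    obtain ⟨d₃, rfl⟩ := hd₂
    refine ⟨⟨d₃, by ring⟩, ?_⟩
    have he₂ : (2 : ℤ) ∣ e₂ := by
      have hz := cast_zmod_eq_zero_of_dvd (n := 2) (pow_dvd_of_le (i := 1) hJ₃ (by norm_num)) (by norm_num)
      push_cast at hz
      exact_mod_cast dvd_of_cast_zmod_eq_zero (q02_s4b _ _ _ _ _ hz)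
    obtain ⟨e₃, rfl⟩ := he₂
    have hJ₄ : (2 : ℤ) ^ 1 ∣ 72 * (2 * α + 1) * c₂ * e₃ + 18 * (2 * b₂ + 1) * c₂ * d₃
        - 54 * (2 * α + 1) * d₃ ^ 2 - 27 * e₃ * (2 * b₂ + 1) ^ 2 - 4 * c₂ ^ 3 :=
      pow_dvd_of_le (dvd_of_dvd_of_eq_mul (n := 4) 1 hJ₃ (by ring) rfl two_ne_zero) (by norm_num)
    have he₃ : (2 : ℤ) ∣ e₃ := by
      have hz := cast_zmod_eq_zero_of_dvd (n := 2) hJ₄ (by norm_num)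
      push_cast at hz
      exact_mod_cast dvd_of_cast_zmod_eq_zero (q02_s4c _ _ _ _ _ hz)
    obtain ⟨e₄, rfl⟩ := he₃
    exact ⟨e₄, by ring⟩

end Two

/-! ## §E₂ Assembly: Stoll–Cremona Prop. A.5 (last statement) = Birch–Swinnerton-Dyer Lemma 5 -/

section Assembly

/-- **Birch–Swinnerton-Dyer, Lemma 5 = Bhargava–Shankar, Lemma 5.5 = Stoll–Cremona, Prop. A.5
(last statement), proved**: an integral binary quartic form `f` with `2⁶ ∣ I(f)`, `2⁹ ∣ J(f)`,
`2¹⁰ ∣ 8 I(f) + J(f)` and `z² = f(x, y)` soluble over `ℚ₂` is `ℚ`-equivalent to an integral form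
with invariants `2⁻⁴ I(f)`, `2⁻⁶ J(f)` (`Literature.NumberTheory.EllipticCurves.bsd_minimisation_two`).
Proof by the case analysis of Stoll–Cremona, pp. 238 and 240 (see the module docstring).
[cite: StollCremona2002, Prop. A.5 (proof)] -/
theorem bsd_minimisation_two_holds : bsd_minimisation_two := by
  intro f hI hJ hK hsol
  have hP : Prime (2 : ℤ) := Int.prime_two
  have hP0 : (2 : ℤ) ≠ 0 := by norm_num
  haveI : Fact (Nat.Prime 2) := ⟨Nat.prime_two⟩
  -- unimodular integral substitutions: equivalence, solubility, invariants
  have kequiv_of_det : ∀ (g : BinaryQuartic ℤ) (M : Matrix (Fin 2) (Fin 2) ℤ), M.det = 1 →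
      KEquiv (g.map (Int.castRingHom ℚ)) ((g.subst M).map (Int.castRingHom ℚ)) :=
    fun g M hM ↦ (GL2ZEquiv.pgl2Equiv_map ⟨M, by rw [hM]; exact isUnit_one, rfl⟩).kEquiv
  have sol_of_det : ∀ (g : BinaryQuartic ℤ) (M : Matrix (Fin 2) (Fin 2) ℤ), M.det = 1 →
      (g.map (Int.castRingHom ℚ_[2])).IsSoluble →
        ((g.subst M).map (Int.castRingHom ℚ_[2])).IsSoluble := by
    intro g M hM hs
    rw [map_subst, isSoluble_subst_iff]
    · exact hs
    · rw [det_map_ringHom, hM, map_one]; exact one_ne_zero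
  have I_of_det : ∀ (g : BinaryQuartic ℤ) (M : Matrix (Fin 2) (Fin 2) ℤ), M.det = 1 →
      (g.subst M).I = g.I := fun g M hM ↦ by rw [I_subst, hM, one_pow, one_mul]
  have J_of_det : ∀ (g : BinaryQuartic ℤ) (M : Matrix (Fin 2) (Fin 2) ℤ), M.det = 1 →
      (g.subst M).J = g.J := fun g M hM ↦ by rw [J_subst, hM, one_pow, one_mul]
  -- the coefficients after a shear by an even `r`, starting from `2 ∣ a`, `2 ∤ b`, `2 ∣ c, d, e`
  -- with `4 ∣ 3 b r + c`: `v ≥ (1, 0, 2, 1, 1)` and `b` still odd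
  have shear_shape : ∀ (h : BinaryQuartic ℤ) (r : ℤ), (2 : ℤ) ∣ r → (2 : ℤ) ∣ h.a →
      ¬ (2 : ℤ) ∣ h.b → (2 : ℤ) ∣ h.d → (2 : ℤ) ∣ h.e → (2 : ℤ) ^ 2 ∣ 3 * h.b * r + h.c →
      (2 : ℤ) ∣ (h.subst !![1, 0; r, 1]).a ∧ ¬ (2 : ℤ) ∣ (h.subst !![1, 0; r, 1]).b ∧
        (2 : ℤ) ^ 2 ∣ (h.subst !![1, 0; r, 1]).c ∧ (2 : ℤ) ∣ (h.subst !![1, 0; r, 1]).d ∧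
        (2 : ℤ) ∣ (h.subst !![1, 0; r, 1]).e := by
    intro h r hr ha hb hd he hrc
    obtain ⟨r', rfl⟩ := hr
    obtain ⟨a', ha'⟩ := ha
    obtain ⟨d', hd'⟩ := hd
    obtain ⟨e', he'⟩ := he
    rw [subst_lowerShear]
    refine ⟨⟨a', ha'⟩, ?_, ?_, ?_, ?_⟩
    · show ¬ (2 : ℤ) ∣ 4 * h.a * (2 * r') + h.b
      intro h'
      exact hb ((dvd_add_right ⟨4 * h.a * r', by ring⟩).mp h')
    · show (2 : ℤ) ^ 2 ∣ 6 * h.a * (2 * r') ^ 2 + 3 * h.b * (2 * r') + h.c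
      rw [add_assoc]
      exact dvd_add ⟨6 * h.a * r' ^ 2, by ring⟩ hrc
    · show (2 : ℤ) ∣ 4 * h.a * (2 * r') ^ 3 + 3 * h.b * (2 * r') ^ 2 + 2 * h.c * (2 * r') + h.d
      exact ⟨16 * h.a * r' ^ 3 + 6 * h.b * r' ^ 2 + 2 * h.c * r' + d', by rw [hd']; ring⟩
    · show (2 : ℤ) ∣ h.a * (2 * r') ^ 4 + h.b * (2 * r') ^ 3 + h.c * (2 * r') ^ 2 + h.d * (2 * r') + h.e
      exact ⟨8 * h.a * r' ^ 4 + 4 * h.b * r' ^ 3 + 2 * h.c * r' ^ 2 + h.d * r' + e', by rw [he']; ring⟩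
  by_cases h2all : (2 : ℤ) ^ 2 ∣ f.a ∧ (2 : ℤ) ^ 2 ∣ f.b ∧ (2 : ℤ) ^ 2 ∣ f.c ∧
      (2 : ℤ) ^ 2 ∣ f.d ∧ (2 : ℤ) ^ 2 ∣ f.e
  · -- `v(Q) ≥ 2`: Lemma A.1(3)
    obtain ⟨ha, hb, hc, hd, he⟩ := h2all
    exact reduce_three hP0 f ha hb hc hd he
  by_cases h1all : (2 : ℤ) ∣ f.a ∧ (2 : ℤ) ∣ f.b ∧ (2 : ℤ) ∣ f.c ∧ (2 : ℤ) ∣ f.d ∧ (2 : ℤ) ∣ f.e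
  · -- `v(Q) = 1`: `f = 2 f₀`, `v(I₀) ≥ 4`, `v(J₀) ≥ 6`
    obtain ⟨⟨a₀, ha₀⟩, ⟨b₀, hb₀⟩, ⟨c₀, hc₀⟩, ⟨d₀, hd₀⟩, ⟨e₀, he₀⟩⟩ := h1all
    have hff₀ : f = (2 : ℤ) • (⟨a₀, b₀, c₀, d₀, e₀⟩ : BinaryQuartic ℤ) := by
      ext
      · exact ha₀
      · exact hb₀
      · exact hc₀
      · exact hd₀
      · exact he₀
    have hf₀v : ¬ ((2 : ℤ) ∣ a₀ ∧ (2 : ℤ) ∣ b₀ ∧ (2 : ℤ) ∣ c₀ ∧ (2 : ℤ) ∣ d₀ ∧ (2 : ℤ) ∣ e₀) := by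
      rintro ⟨h₁, h₂, h₃, h₄, h₅⟩
      apply h2all
      rw [ha₀, hb₀, hc₀, hd₀, he₀, sq]
      exact ⟨mul_dvd_mul_left _ h₁, mul_dvd_mul_left _ h₂, mul_dvd_mul_left _ h₃,
        mul_dvd_mul_left _ h₄, mul_dvd_mul_left _ h₅⟩
    have hI₀ : (2 : ℤ) ^ 4 ∣ (⟨a₀, b₀, c₀, d₀, e₀⟩ : BinaryQuartic ℤ).I := by
      have h6 : (2 : ℤ) ^ 2 * (2 : ℤ) ^ 4 ∣ (2 : ℤ) ^ 2 * (⟨a₀, b₀, c₀, d₀, e₀⟩ : BinaryQuartic ℤ).I := by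
        have := hI
        rw [hff₀, I_smul] at this
        calc (2 : ℤ) ^ 2 * (2 : ℤ) ^ 4 = (2 : ℤ) ^ 6 := by ring
          _ ∣ _ := this
      exact (mul_dvd_mul_iff_left (pow_ne_zero 2 hP0)).mp h6
    have hJ₀ : (2 : ℤ) ^ 6 ∣ (⟨a₀, b₀, c₀, d₀, e₀⟩ : BinaryQuartic ℤ).J := by
      have h9 : (2 : ℤ) ^ 3 * (2 : ℤ) ^ 6 ∣ (2 : ℤ) ^ 3 * (⟨a₀, b₀, c₀, d₀, e₀⟩ : BinaryQuartic ℤ).J := by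
        have := hJ
        rw [hff₀, J_smul] at this
        calc (2 : ℤ) ^ 3 * (2 : ℤ) ^ 6 = (2 : ℤ) ^ 9 := by ring
          _ ∣ _ := this
      exact (mul_dvd_mul_iff_left (pow_ne_zero 3 hP0)).mp h9
    obtain ⟨M, hMdet, hshape⟩ := exists_sl2_shape₂ (⟨a₀, b₀, c₀, d₀, e₀⟩ : BinaryQuartic ℤ) hf₀v
      ((dvd_pow_self (2 : ℤ) four_ne_zero).trans hI₀)
      ((dvd_pow_self (2 : ℤ) (by norm_num : (6 : ℕ) ≠ 0)).trans hJ₀)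
    obtain ⟨h, hh⟩ : ∃ h : BinaryQuartic ℤ, (⟨a₀, b₀, c₀, d₀, e₀⟩ : BinaryQuartic ℤ).subst M = h :=
      ⟨_, rfl⟩
    have hIh : (2 : ℤ) ^ 4 ∣ h.I := by rw [← hh, I_of_det _ M hMdet]; exact hI₀
    have hJh : (2 : ℤ) ^ 6 ∣ h.J := by rw [← hh, J_of_det _ M hMdet]; exact hJ₀
    have hfM : f.subst M = (2 : ℤ) • h := by rw [hff₀, smul_subst, hh]
    rw [hh] at hshape
    obtain ⟨f₁, hf₁⟩ : ∃ f₁ : BinaryQuartic ℤ, f.subst M = f₁ := ⟨_, rfl⟩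
    have hIf₁ : f₁.I = f.I := by rw [← hf₁, I_of_det f M hMdet]
    have hJf₁ : f₁.J = f.J := by rw [← hf₁, J_of_det f M hMdet]
    have hK₁ : KEquiv (f.map (Int.castRingHom ℚ)) (f₁.map (Int.castRingHom ℚ)) := by
      rw [← hf₁]; exact kequiv_of_det f M hMdet
    have hsol₁ : (f₁.map (Int.castRingHom ℚ_[2])).IsSoluble := by
      rw [← hf₁]; exact sol_of_det f M hMdet hsol
    have hf₁' : f₁ = (2 : ℤ) • h := by rw [← hf₁, hfM]
    rcases hshape with ⟨ha, hb, hc, hd, he⟩ | ⟨ha, hb, hc, hd, he⟩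
    · -- quadruple root, `v(Q) = 1`
      have e_a : f₁.a = 2 * h.a := by rw [hf₁', smul_a]
      have e_b : f₁.b = 2 * h.b := by rw [hf₁', smul_b]
      have e_c : f₁.c = 2 * h.c := by rw [hf₁', smul_c]
      have e_d : f₁.d = 2 * h.d := by rw [hf₁', smul_d]
      have e_e : f₁.e = 2 * h.e := by rw [hf₁', smul_e]
      obtain ⟨hc4, hd4, he4⟩ := chase_quadruple₁₂ ha hb hc hd he (by simpa only [I] using hIh)
        (pow_dvd_of_le (by simpa only [J] using hJh) (by norm_num))
      have hb₁ : (2 : ℤ) ^ 2 ∣ f₁.b := by rw [e_b, sq]; exact mul_dvd_mul_left _ hb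
      have hc₁ : (2 : ℤ) ^ 3 ∣ f₁.c := by rw [e_c, pow_succ']; exact mul_dvd_mul_left _ hc4
      have hd₁ : (2 : ℤ) ^ 3 ∣ f₁.d := by rw [e_d, pow_succ']; exact mul_dvd_mul_left _ hd4
      obtain ⟨e₁, he₁⟩ := he4
      have he₁' : f₁.e = (2 : ℤ) ^ 3 * e₁ := by rw [e_e, he₁]; ring
      have he4 : (2 : ℤ) ^ 4 ∣ f₁.e := by
        by_contra hne
        have hodd : ¬ (2 : ℤ) ∣ e₁ := fun h' ↦
          hne (by rw [he₁', show (4 : ℕ) = 3 + 1 from rfl, pow_succ]; exact mul_dvd_mul_left _ h')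
        exact not_isSoluble_of_valuations (p := 2) f₁ (a₀ := h.a) (e₀ := e₁)
          (by rw [e_a]; norm_num) (by exact_mod_cast ha) (by exact_mod_cast hb₁)
          (by exact_mod_cast pow_dvd_of_le hc₁ (by norm_num)) (by exact_mod_cast hd₁)
          (by rw [he₁']; norm_num) (by exact_mod_cast hodd) hsol₁
      obtain ⟨f', hK, hI', hJ'⟩ := reduce_one hP0 f₁ ((dvd_pow_self _ two_ne_zero).trans hb₁)
        (pow_dvd_of_le hc₁ (by norm_num)) hd₁ he4
      exact ⟨f', TwoCovering.kEquiv_trans hK₁ hK, by rw [hI', hIf₁], by rw [hJ', hJf₁]⟩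
    · -- triple root, `v(Q) = 1`: shear, then chase on `h`
      obtain ⟨r, hr, hrc⟩ := exists_shear₂ hb hc
      have hLdet : (!![1, 0; r, 1] : Matrix (Fin 2) (Fin 2) ℤ).det = 1 := det_lowerShear r
      obtain ⟨h₂, hh₂⟩ : ∃ h₂ : BinaryQuartic ℤ, h.subst !![1, 0; r, 1] = h₂ := ⟨_, rfl⟩
      obtain ⟨ha', hb', hc', hd', he'⟩ := shear_shape h r hr ha hb hd he hrc
      rw [hh₂] at ha' hb' hc' hd' he'
      have hIh₂ : (2 : ℤ) ^ 4 ∣ h₂.I := by rw [← hh₂, I_of_det _ _ hLdet]; exact hIh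
      have hJh₂ : (2 : ℤ) ^ 6 ∣ h₂.J := by rw [← hh₂, J_of_det _ _ hLdet]; exact hJh
      obtain ⟨hd4, he6⟩ := chase_triple₂ ha' hb' hc' he' (by simpa only [I] using hIh₂)
        (by simpa only [J] using hJh₂)
      obtain ⟨f₂, hf₂⟩ : ∃ f₂ : BinaryQuartic ℤ, f₁.subst !![1, 0; r, 1] = f₂ := ⟨_, rfl⟩
      have hf₂' : f₂ = (2 : ℤ) • h₂ := by rw [← hf₂, hf₁', smul_subst, hh₂]
      have hIf₂ : f₂.I = f.I := by rw [← hf₂, I_of_det f₁ _ hLdet, hIf₁]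
      have hJf₂ : f₂.J = f.J := by rw [← hf₂, J_of_det f₁ _ hLdet, hJf₁]
      have hK₂ : KEquiv (f₁.map (Int.castRingHom ℚ)) (f₂.map (Int.castRingHom ℚ)) := by
        rw [← hf₂]; exact kequiv_of_det f₁ _ hLdet
      have hb₂ : (2 : ℤ) ∣ f₂.b := by rw [hf₂', smul_b]; exact dvd_mul_right _ _
      have hc₂ : (2 : ℤ) ^ 2 ∣ f₂.c := by
        rw [hf₂', smul_c]; exact (pow_dvd_of_le hc' (by norm_num)).mul_left _
      have hd₂ : (2 : ℤ) ^ 3 ∣ f₂.d := by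
        rw [hf₂', smul_d]; exact (pow_dvd_of_le hd4 (by norm_num)).mul_left _
      have he₂ : (2 : ℤ) ^ 4 ∣ f₂.e := by
        rw [hf₂', smul_e]; exact (pow_dvd_of_le he6 (by norm_num)).mul_left _
      obtain ⟨f', hK, hI', hJ'⟩ := reduce_one hP0 f₂ hb₂ hc₂ hd₂ he₂
      exact ⟨f', TwoCovering.kEquiv_trans hK₁ (TwoCovering.kEquiv_trans hK₂ hK),
        by rw [hI', hIf₂], by rw [hJ', hJf₂]⟩
  · -- `v(Q) = 0`
    obtain ⟨M, hMdet, hshape⟩ := exists_sl2_shape₂ f h1all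
      ((dvd_pow_self (2 : ℤ) (by norm_num : (6 : ℕ) ≠ 0)).trans hI)
      ((dvd_pow_self (2 : ℤ) (by norm_num : (9 : ℕ) ≠ 0)).trans hJ)
    obtain ⟨f₁, hf₁⟩ : ∃ f₁ : BinaryQuartic ℤ, f.subst M = f₁ := ⟨_, rfl⟩
    have hIf₁ : f₁.I = f.I := by rw [← hf₁, I_of_det f M hMdet]
    have hJf₁ : f₁.J = f.J := by rw [← hf₁, J_of_det f M hMdet]
    have hI₁ : (2 : ℤ) ^ 6 ∣ f₁.I := by rw [hIf₁]; exact hI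
    have hJ₁ : (2 : ℤ) ^ 9 ∣ f₁.J := by rw [hJf₁]; exact hJ
    have hK₁' : (2 : ℤ) ^ 10 ∣ 8 * f₁.I + f₁.J := by rw [hIf₁, hJf₁]; exact hK
    have hK₁ : KEquiv (f.map (Int.castRingHom ℚ)) (f₁.map (Int.castRingHom ℚ)) := by
      rw [← hf₁]; exact kequiv_of_det f M hMdet
    rw [hf₁] at hshape
    rcases hshape with ⟨ha, hb, hc, hd, he⟩ | ⟨ha, hb, hc, hd, he⟩
    · -- quadruple root, `v(Q) = 0`
      obtain ⟨hc2, hd3, he4⟩ := chase_quadruple₀₂ ha hb hc hd he (by simpa only [I] using hI₁)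
        (by simpa only [J] using hJ₁) (by simpa only [I, J] using hK₁')
      obtain ⟨f', hK, hI', hJ'⟩ := reduce_one hP0 f₁ hb hc2 hd3 he4
      exact ⟨f', TwoCovering.kEquiv_trans hK₁ hK, by rw [hI', hIf₁], by rw [hJ', hJf₁]⟩
    · -- triple root, `v(Q) = 0`: shear, chase, Lemma A.1(2)
      obtain ⟨r, hr, hrc⟩ := exists_shear₂ hb hc
      have hLdet : (!![1, 0; r, 1] : Matrix (Fin 2) (Fin 2) ℤ).det = 1 := det_lowerShear r
      obtain ⟨f₂, hf₂⟩ : ∃ f₂ : BinaryQuartic ℤ, f₁.subst !![1, 0; r, 1] = f₂ := ⟨_, rfl⟩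
      obtain ⟨ha', hb', hc', hd', he'⟩ := shear_shape f₁ r hr ha hb hd he hrc
      rw [hf₂] at ha' hb' hc' hd' he'
      have hIf₂ : f₂.I = f.I := by rw [← hf₂, I_of_det f₁ _ hLdet, hIf₁]
      have hJf₂ : f₂.J = f.J := by rw [← hf₂, J_of_det f₁ _ hLdet, hJf₁]
      have hI₂ : (2 : ℤ) ^ 4 ∣ f₂.I := by rw [hIf₂]; exact pow_dvd_of_le hI (by norm_num)
      have hJ₂ : (2 : ℤ) ^ 6 ∣ f₂.J := by rw [hJf₂]; exact pow_dvd_of_le hJ (by norm_num)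
      have hK₂ : KEquiv (f₁.map (Int.castRingHom ℚ)) (f₂.map (Int.castRingHom ℚ)) := by
        rw [← hf₂]; exact kequiv_of_det f₁ _ hLdet
      obtain ⟨hd4, he6⟩ := chase_triple₂ ha' hb' hc' he' (by simpa only [I] using hI₂)
        (by simpa only [J] using hJ₂)
      obtain ⟨f', hK, hI', hJ'⟩ := reduce_two hP0 f₂ hc' hd4 he6
      exact ⟨f', TwoCovering.kEquiv_trans hK₁ (TwoCovering.kEquiv_trans hK₂ hK),
        by rw [hI', hIf₂], by rw [hJ', hJf₂]⟩

end Assembly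

end BinaryQuartic

/-- Re-export at the level of the named fact's namespace: **Bhargava–Shankar Lemma 5.5 /
Birch–Swinnerton-Dyer Lemma 5 holds** (`bsd_minimisation_two`).
[cite: BhargavaShankarAnnals2015, Lemma 5.5 (arXiv:1006.1002v2 numbering)] -/
theorem bsd_minimisation_two_holds : bsd_minimisation_two :=
  BinaryQuartic.bsd_minimisation_two_holds

/-! ## The current frontier of the decomposition of `averageRankLE_three_halves`

With Lemmas 5.3, 5.4 and 5.5 discharged (`bsd_minimisation_prime_five_le_holds`,
`bsd_minimisation_three_holds`, `bsd_minimisation_two_holds`), Bhargava–Shankar's Theorem 5.6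
depends on exactly one named fact of the held arXiv text — Lemma 5.2, the Birch–Swinnerton-Dyer
correspondence `bhargavaShankar_card_selmerTwo_eq_kEquivClassCount` — and Theorem 1.1 and
Cor. 1.2 on that and two more: eq. (31) with Prop. 5.12 and Lemma 5.16
(`bhargavaShankar_sum_irredClassCount_asymptotic`, the geometry of numbers of §2) and Prop. 5.8
(`bhargavaShankar_sum_card_selmerTwo_twoTorsion_le`). -/

/-- **Bhargava–Shankar, Theorem 5.6, granted Lemma 5.2 only** (Lemmas 5.3, 5.4, 5.5 being
proved). [cite: BhargavaShankarAnnals2015, Thm 5.6 (arXiv:1006.1002v2 numbering; §5.1)] -/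
theorem bhargavaShankar_card_selmerTwo_eq_of_bsd_correspondence
    (h52 : bhargavaShankar_card_selmerTwo_eq_kEquivClassCount) :
    bhargavaShankar_card_selmerTwo_eq :=
  bhargavaShankar_card_selmerTwo_eq_of_facts h52 bsd_minimisation_prime_five_le_holds
    bsd_minimisation_three_holds bsd_minimisation_two_holds

/-- **Bhargava–Shankar, Theorem 1.1, granted the three remaining printed inputs** (Lemma 5.2,
eq. (31), Prop. 5.8). [cite: BhargavaShankarAnnals2015, Thm 1.1 (arXiv:1006.1002v2 numbering)] -/
theorem average_card_selmerTwo_of_three_facts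
    (h52 : bhargavaShankar_card_selmerTwo_eq_kEquivClassCount)
    (h31 : bhargavaShankar_sum_irredClassCount_asymptotic)
    (h58 : bhargavaShankar_sum_card_selmerTwo_twoTorsion_le) :
    EllipticCurves.average_card_selmerTwo :=
  average_card_selmerTwo_of_BSD_facts h52 bsd_minimisation_prime_five_le_holds
    bsd_minimisation_three_holds bsd_minimisation_two_holds h31 h58

/-- **Bhargava–Shankar, Cor. 1.2 (`averageRankLE_three_halves`), granted the three remaining
printed inputs**: Lemma 5.2 (the `2`-covering/Selmer correspondence), eq. (31) (the
geometry-of-numbers count, with Prop. 5.12 and Lemma 5.16) and Prop. 5.8 of the held arXiv text;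
everything else in the paper's derivation of Cor. 1.2 — Theorem 5.6 from [BSD]'s three
minimisation lemmas, Theorem 1.1 from (31), Prop. 5.8 and Theorem 5.6, and Cor. 1.2 from
Theorem 1.1 — is proved in the tree. [cite: BhargavaShankarAnnals2015, Cor. 1.2] -/
theorem averageRankLE_three_halves_of_three_facts
    (h52 : bhargavaShankar_card_selmerTwo_eq_kEquivClassCount)
    (h31 : bhargavaShankar_sum_irredClassCount_asymptotic)
    (h58 : bhargavaShankar_sum_card_selmerTwo_twoTorsion_le) :
    EllipticCurves.averageRankLE_three_halves :=
  averageRankLE_three_halves_of_BSD_facts h52 bsd_minimisation_prime_five_le_holds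
    bsd_minimisation_three_holds bsd_minimisation_two_holds h31 h58

end Literature.NumberTheory.EllipticCurves

end
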